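import Mathlib.Combinatorics.SimpleGraph.Prod
import Mathlib.Combinatorics.SimpleGraph.Hasse
import Literature.Combinatorics.SimpleGraph.KuratowskiPlanarity
import HarnessLib

/-!
# Planar graphs are minors of grids: Robertson–Seymour–Thomas 1994, (1.5)

[topic Combinatorics/SimpleGraph]

TYPED STATEMENT (named fact, not proved here) of statement **(1.5)** of N. Robertson, P. Seymour,
R. Thomas, *Quickly excluding a planar graph*, J. Combin. Theory Ser. B 62 (1994) 323–348
[RobertsonSeymourThomas1994] (the paper's main theorem is the tree-width bound for graphs
excluding a planar graph; (1.5) is its grid-minor lemma). The held copy of the primary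
(`paper:doi-10-1006-jctb-1994-1073`, 26 pp.) has NO text layer; (1.5) is quoted, with its number,
by S. Oum, *Rank-width and vertex-minors*, J. Combin. Theory Ser. B 95 (2005) [Oum2005], Lemma 3.8
(held text `paper:doi-10-1016-j-jctb-2005-03-003`, lit-read p0011 L26–27): "Lemma 3.8 (Robertson
et al. [23, (1.5)]). If `H` is a planar graph with `|V(H)| + 2|E(H)| ≤ n`, then `H` is isomorphic to
a minor of the `2n × 2n` grid." (Oum, p0011 L12: "The `n × n` grid is a graph on the vertex set
`{1, 2, …, n} × {1, 2, …, n}`".) This is the form typed below, specialised to SIMPLE graphs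
(RST's graphs may have loops and parallel edges, so the specialisation is weaker than print, never
stronger).

NOT typed (recorded for users): the `n`-vertex form "the `2n × 2n`-grid contains as minor every
planar graph with `n` vertices" printed by C. Gavoille, C. Hilaire, *Minor-universal graph for
graphs on surfaces*, arXiv:2305.06673 [GavoilleHilaire2023] (§1, p. 3, lit-read p0003 L50–53, and
abstract p0002 L7–11) and attributed there to [RST94]; for simple graphs it is stronger than (1.5)
as printed (an `n`-vertex simple planar graph has `|V| + 2|E| ≤ 7n − 12`, so (1.5) gives the
`(14n−24) × (14n−24)` grid) and follows from the ingredients of RST's proof (every `n`-vertex planar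
graph is a minor of a Hamiltonian planar graph with `≤ 2n` vertices, which is a minor of the
`2n × 2n` grid; GavoilleHilaire2023 pp. 6, 8). Users needing only "a grid of side `O(|V| + |E|)`"
(e.g. cubic graphs, `|E| = 3|V|/2`) are served by (1.5) as typed.

Vocabulary (all existing): minors `IsMinor` (`H ≼ₘ G`, `SubcubicMinors.lean`); planarity
`IsPlanar` (Kuratowski form, `KuratowskiPlanarity.lean`); the `2n × 2n` grid (`2n` rows and `2n`
columns, `4n²` vertices) is Mathlib's box product of two paths `pathGraph (2n) □ pathGraph (2n)` on
`Fin (2n) × Fin (2n)` — for `n ≥ 1` literally the tree's `grid (2n-1) (2n-1)`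
(`WallTopologicalMinor.lean`, which indexes grids by cells: `grid a b` has `(a+1)(b+1)` vertices);
`|E(H)|` is `Nat.card H.edgeSet` (instance-free).

## References

* [RobertsonSeymourThomas1994] N. Robertson, P. Seymour, R. Thomas, *Quickly excluding a planar
  graph*, J. Combin. Theory Ser. B 62 (1994) 323–348, doi:10.1006/jctb.1994.1073, statement (1.5)
  (primary; held PDF without text layer).
* [Oum2005] S. Oum, *Rank-width and vertex-minors*, J. Combin. Theory Ser. B 95 (2005) 79–100,
  Lemma 3.8 — verbatim quotation of (1.5) with its number. Read: held text p. 11.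
* [GavoilleHilaire2023] C. Gavoille, C. Hilaire, *Minor-universal graph for graphs on surfaces*,
  arXiv:2305.06673 (2023), §1 — the `n`-vertex form (not typed). Read: held text pp. 2–3, 6, 8
  (the store's title metadata for this key is wrong; the text is this paper).
-/

namespace Literature.Combinatorics.SimpleGraph

open _root_.SimpleGraph

/-- **Robertson–Seymour–Thomas 1994, (1.5) (planar graphs are grid minors)**: "If `H` is a planar
graph with `|V(H)| + 2|E(H)| ≤ n`, then `H` is isomorphic to a minor of the `2n × 2n` grid." — for
every finite simple planar graph `H` (`IsPlanar`, Kuratowski form) with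
`|V(H)| + 2|E(H)| ≤ n`, `H` is a minor (`IsMinor`, branch-set form; "isomorphic to a minor" is the
same thing for this notion) of the `2n × 2n` grid `pathGraph (2n) □ pathGraph (2n)` (`4n²`
vertices). Simple-graph specialisation of the printed multigraph statement. NOT proved here.
[cite: RobertsonSeymourThomas1994, (1.5) (as quoted verbatim with its number in Oum2005, Lemma 3.8, lit-read p0011 L26–27); Oum2005, Lemma 3.8] -/
def RobertsonSeymourThomas1994_gridMinor : Prop :=
  ∀ (n : ℕ) (α : Type) [Fintype α] (H : SimpleGraph α),
    IsPlanar H → Fintype.card α + 2 * Nat.card H.edgeSet ≤ n →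
      IsMinor H (pathGraph (2 * n) □ pathGraph (2 * n))

end Literature.Combinatorics.SimpleGraph
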